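import Summits.FinalStateConjecture.FinalStateConjecture.Theorems.EIHFluxBalanceInertialRecessionChargeKinematicsEscapeBudgets

/-!
# Route EIHFluxBalance — `InertialRecession`, line `old-light-leaves-the-cone`: charge kinematics,
# XIV (regime split; relative freezing of the tight pair)

Helper file for the crux `stmt-FinalStateConjecture-10166`
(`Summit.FinalStateConjecture.FinalStateConjecture.Theses.EIHFluxBalance.InertialRecession`), second line
lead, endgame stub `stub_expandingChargeKinematics` (S4: abstract quasi-conserved window charges with the
slack-form window law and the single-hole identification ⇒ Cesàro velocities of the painted centres).
THE ESCAPE SERIES: the endgame for `N = 3` (Case A all-pairs freezing is `ChargeKinematicsAllPairs*`;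
Case B, the escape of a fast hole from a velocity-tight pair, is this series; the assembly is
`ChargeKinematicsThree`).

XIV — THE REGIME SPLIT of an interval by three monotone-type continuous functions (`regime_split`: WIDE /
APPROACH / PASSAGE / RECESSION) and THE RELATIVE FREEZING OF THE TIGHT PAIR during the escape
(`tight_pair_relative_freezing`: nested first exit; `d_ac` becomes fly-by controlled once the relative
velocity reaches `β₀`).

Every statement is Mathlib-only real analysis over the stub's verbatim hypotheses ([folklore]); the abstract
charge `P` is arbitrary (adversarial), constrained only by the window law and the identification.
-/

set_option linter.dupNamespace false

noncomputable section

open Filter Set Metric Real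
open scoped Topology

namespace Summit.FinalStateConjecture.FinalStateConjecture.Theorems.ChargeKinematics

open Literature.Geometry.Lorentzian

/-! ## The regime split -/

section RegimeSplit

open MeasureTheory intervalIntegral

/-- `f < 0` on `[a, σ)` with `a < σ` forces `f σ ≤ 0` (continuity). [folklore] -/
theorem nonpos_of_neg_on_left {f : ℝ → ℝ} (hf : Continuous f) {a σ : ℝ} (h : a < σ)
    (hlt : ∀ s, a ≤ s → s < σ → f s < 0) : f σ ≤ 0 := by
  have htend : Tendsto f (𝓝[<] σ) (𝓝 (f σ)) := (hf.tendsto σ).mono_left nhdsWithin_le_nhds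
  have hev : ∀ᶠ s in 𝓝[<] σ, f s ≤ 0 := by
    filter_upwards [Ioo_mem_nhdsLT h] with s hs
    exact (hlt s hs.1.le hs.2).le
  exact le_of_tendsto htend hev

/-- `f < 0` on `(σ, b]` with `σ < b` forces `f σ ≤ 0` (continuity). [folklore] -/
theorem nonpos_of_neg_on_right {f : ℝ → ℝ} (hf : Continuous f) {σ b : ℝ} (h : σ < b)
    (hlt : ∀ s, σ < s → s ≤ b → f s < 0) : f σ ≤ 0 := by
  have htend : Tendsto f (𝓝[>] σ) (𝓝 (f σ)) := (hf.tendsto σ).mono_left nhdsWithin_le_nhds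
  have hev : ∀ᶠ s in 𝓝[>] σ, f s ≤ 0 := by
    filter_upwards [Ioo_mem_nhdsGT h] with s hs
    exact (hlt s hs.1 hs.2.le).le
  exact le_of_tendsto htend hev

/-- **The regime split.** On `[t₀, τ]` let `k, g⁻, g⁺` be continuous, with `{k ≥ 0}` and `{g⁺ ≥ 0}`
final (once nonnegative, nonnegative ever after) and `{g⁻ ≥ 0}` initial. Then
`[t₀, τ]` splits into four consecutive closed intervals — WIDE (`k ≤ 0`), APPROACH (`k ≥ 0`, `g⁻ ≥ 0`),
PASSAGE (`k ≥ 0`, `g⁻ ≤ 0`, `g⁺ ≤ 0`), RECESSION (`k ≥ 0`, `g⁺ ≥ 0`) — each possibly degenerate (then no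
condition is asserted). In the escape lemma `k = c₂s/2 − d_ac`, `g^∓ = ∓φ_ba − 4d_ac`. [folklore] -/
theorem regime_split {k gm gp : ℝ → ℝ} {t₀ τ : ℝ} (hτ : t₀ ≤ τ)
    (hk : Continuous k) (hgm : Continuous gm) (hgp : Continuous gp)
    (hkmono : ∀ s s', t₀ ≤ s → s ≤ s' → s' ≤ τ → 0 ≤ k s → 0 ≤ k s')
    (hgmmono : ∀ s s', t₀ ≤ s → s ≤ s' → s' ≤ τ → 0 ≤ gm s' → 0 ≤ gm s)
    (hgpmono : ∀ s s', t₀ ≤ s → s ≤ s' → s' ≤ τ → 0 ≤ gp s → 0 ≤ gp s') :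
    ∃ σ₁ σ₂ σ₃ : ℝ, t₀ ≤ σ₁ ∧ σ₁ ≤ σ₂ ∧ σ₂ ≤ σ₃ ∧ σ₃ ≤ τ ∧
      (σ₁ = t₀ ∨ ∀ s ∈ Set.Icc t₀ σ₁, k s ≤ 0) ∧
      (σ₂ = σ₁ ∨ ∀ s ∈ Set.Icc σ₁ σ₂, 0 ≤ k s ∧ 0 ≤ gm s) ∧
      (σ₃ = σ₂ ∨ ∀ s ∈ Set.Icc σ₂ σ₃, 0 ≤ k s ∧ gm s ≤ 0 ∧ gp s ≤ 0) ∧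
      (τ = σ₃ ∨ ∀ s ∈ Set.Icc σ₃ τ, 0 ≤ k s ∧ 0 ≤ gp s) := by
  -- STEP 1: `σ₁`, the first time `k ≥ 0` (or `τ`)
  by_cases hK : ∀ s ∈ Set.Icc t₀ τ, k s < 0
  · refine ⟨τ, τ, τ, hτ, le_rfl, le_rfl, le_rfl, Or.inr fun s hs ↦ (hK s hs).le, Or.inl rfl,
      Or.inl rfl, Or.inl rfl⟩
  push Not at hK
  obtain ⟨s₁, hs₁, hks₁⟩ := hK
  set S₁ : Set ℝ := {s | s ∈ Set.Icc t₀ τ ∧ 0 ≤ k s} with hS₁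
  have hS₁ne : S₁.Nonempty := ⟨s₁, hs₁, hks₁⟩
  have hS₁bdd : BddBelow S₁ := ⟨t₀, fun s hs ↦ hs.1.1⟩
  have hS₁closed : IsClosed S₁ := isClosed_Icc.inter (isClosed_le continuous_const hk)
  set σ₁ := sInf S₁ with hσ₁def
  have hσ₁S : σ₁ ∈ S₁ := hS₁closed.csInf_mem hS₁ne hS₁bdd
  have hσ₁t₀ : t₀ ≤ σ₁ := hσ₁S.1.1
  have hσ₁τ : σ₁ ≤ τ := hσ₁S.1.2
  have hkσ₁ : 0 ≤ k σ₁ := hσ₁S.2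
  have hkneg : ∀ s, t₀ ≤ s → s < σ₁ → k s < 0 := by
    intro s hs hsσ
    by_contra hcon
    push Not at hcon
    exact absurd (csInf_le hS₁bdd ⟨⟨hs, hsσ.le.trans hσ₁τ⟩, hcon⟩) (not_le.mpr hsσ)
  have hkpos : ∀ s, σ₁ ≤ s → s ≤ τ → 0 ≤ k s := fun s hs hsτ ↦ hkmono σ₁ s hσ₁t₀ hs hsτ hkσ₁
  have hW : σ₁ = t₀ ∨ ∀ s ∈ Set.Icc t₀ σ₁, k s ≤ 0 := by
    rcases eq_or_lt_of_le hσ₁t₀ with h | h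
    · exact Or.inl h.symm
    · refine Or.inr fun s hs ↦ ?_
      rcases eq_or_lt_of_le hs.2 with h' | h'
      · rw [h']; exact nonpos_of_neg_on_left hk h hkneg
      · exact (hkneg s hs.1 h').le
  -- STEP 2: `σ₂`, the last time in `[σ₁, τ]` with `g⁻ ≥ 0` (or `σ₁`)
  by_cases hGm : ∀ s ∈ Set.Icc σ₁ τ, gm s < 0
  · -- no approach phase: σ₂ = σ₁
    -- STEP 3 inside: `σ₃`, the first time in `[σ₁, τ]` with `g⁺ ≥ 0` (or `τ`)
    by_cases hGp : ∀ s ∈ Set.Icc σ₁ τ, gp s < 0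
    · refine ⟨σ₁, σ₁, τ, hσ₁t₀, le_rfl, hσ₁τ, le_rfl, hW, Or.inl rfl, ?_, Or.inl rfl⟩
      exact Or.inr fun s hs ↦ ⟨hkpos s hs.1 hs.2, (hGm s hs).le, (hGp s hs).le⟩
    · push Not at hGp
      obtain ⟨s₃, hs₃, hgs₃⟩ := hGp
      set S₃ : Set ℝ := {s | s ∈ Set.Icc σ₁ τ ∧ 0 ≤ gp s} with hS₃
      have hS₃ne : S₃.Nonempty := ⟨s₃, hs₃, hgs₃⟩
      have hS₃bdd : BddBelow S₃ := ⟨σ₁, fun s hs ↦ hs.1.1⟩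
      have hS₃closed : IsClosed S₃ := isClosed_Icc.inter (isClosed_le continuous_const hgp)
      set σ₃ := sInf S₃ with hσ₃def
      have hσ₃S : σ₃ ∈ S₃ := hS₃closed.csInf_mem hS₃ne hS₃bdd
      have hgpneg : ∀ s, σ₁ ≤ s → s < σ₃ → gp s < 0 := by
        intro s hs hsσ
        by_contra hcon
        push Not at hcon
        exact absurd (csInf_le hS₃bdd ⟨⟨hs, hsσ.le.trans hσ₃S.1.2⟩, hcon⟩) (not_le.mpr hsσ)
      refine ⟨σ₁, σ₁, σ₃, hσ₁t₀, le_rfl, hσ₃S.1.1, hσ₃S.1.2, hW, Or.inl rfl, ?_, ?_⟩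
      · rcases eq_or_lt_of_le hσ₃S.1.1 with h | h
        · exact Or.inl h.symm
        · refine Or.inr fun s hs ↦ ⟨hkpos s hs.1 (hs.2.trans hσ₃S.1.2),
            (hGm s ⟨hs.1, hs.2.trans hσ₃S.1.2⟩).le, ?_⟩
          rcases eq_or_lt_of_le hs.2 with h' | h'
          · rw [h']; exact nonpos_of_neg_on_left hgp h hgpneg
          · exact (hgpneg s hs.1 h').le
      · exact Or.inr fun s hs ↦ ⟨hkpos s (hσ₃S.1.1.trans hs.1) hs.2,
          hgpmono σ₃ s (hσ₁t₀.trans hσ₃S.1.1) hs.1 hs.2 hσ₃S.2⟩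
  · push Not at hGm
    obtain ⟨s₂, hs₂, hgs₂⟩ := hGm
    set S₂ : Set ℝ := {s | s ∈ Set.Icc σ₁ τ ∧ 0 ≤ gm s} with hS₂
    have hS₂ne : S₂.Nonempty := ⟨s₂, hs₂, hgs₂⟩
    have hS₂bdd : BddAbove S₂ := ⟨τ, fun s hs ↦ hs.1.2⟩
    have hS₂closed : IsClosed S₂ := isClosed_Icc.inter (isClosed_le continuous_const hgm)
    set σ₂ := sSup S₂ with hσ₂def
    have hσ₂S : σ₂ ∈ S₂ := hS₂closed.csSup_mem hS₂ne hS₂bdd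
    have hσ₁σ₂ : σ₁ ≤ σ₂ := hσ₂S.1.1
    have hσ₂τ : σ₂ ≤ τ := hσ₂S.1.2
    have hgmneg : ∀ s, σ₂ < s → s ≤ τ → gm s < 0 := by
      intro s hs hsτ
      by_contra hcon
      push Not at hcon
      exact absurd (le_csSup hS₂bdd ⟨⟨hσ₁σ₂.trans hs.le, hsτ⟩, hcon⟩) (not_le.mpr hs)
    have hgmpos : ∀ s, σ₁ ≤ s → s ≤ σ₂ → 0 ≤ gm s := fun s hs hs₂ ↦
      hgmmono s σ₂ (hσ₁t₀.trans hs) hs₂ hσ₂τ hσ₂S.2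
    have hA : σ₂ = σ₁ ∨ ∀ s ∈ Set.Icc σ₁ σ₂, 0 ≤ k s ∧ 0 ≤ gm s :=
      Or.inr fun s hs ↦ ⟨hkpos s hs.1 (hs.2.trans hσ₂τ), hgmpos s hs.1 hs.2⟩
    -- `g⁺ < 0` on `[σ₁, σ₂]` (exclusion), and `g⁻ ≤ 0` at `σ₂` when `σ₂ < τ`
    have hgmσ₂ : σ₂ < τ → gm σ₂ ≤ 0 := fun h ↦ nonpos_of_neg_on_right hgm h hgmneg
    -- STEP 3: `σ₃`, the first time in `[σ₂, τ]` with `g⁺ ≥ 0` (or `τ`)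
    by_cases hGp : ∀ s ∈ Set.Icc σ₂ τ, gp s < 0
    · refine ⟨σ₁, σ₂, τ, hσ₁t₀, hσ₁σ₂, hσ₂τ, le_rfl, hW, hA, ?_, Or.inl rfl⟩
      rcases eq_or_lt_of_le hσ₂τ with h | h
      · exact Or.inl h.symm
      · refine Or.inr fun s hs ↦ ⟨hkpos s (hσ₁σ₂.trans hs.1) hs.2, ?_, (hGp s hs).le⟩
        rcases eq_or_lt_of_le hs.1 with h' | h'
        · rw [← h']; exact hgmσ₂ h
        · exact (hgmneg s h' hs.2).le
    · push Not at hGp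
      obtain ⟨s₃, hs₃, hgs₃⟩ := hGp
      set S₃ : Set ℝ := {s | s ∈ Set.Icc σ₂ τ ∧ 0 ≤ gp s} with hS₃
      have hS₃ne : S₃.Nonempty := ⟨s₃, hs₃, hgs₃⟩
      have hS₃bdd : BddBelow S₃ := ⟨σ₂, fun s hs ↦ hs.1.1⟩
      have hS₃closed : IsClosed S₃ := isClosed_Icc.inter (isClosed_le continuous_const hgp)
      set σ₃ := sInf S₃ with hσ₃def
      have hσ₃S : σ₃ ∈ S₃ := hS₃closed.csInf_mem hS₃ne hS₃bdd
      have hgpneg : ∀ s, σ₂ ≤ s → s < σ₃ → gp s < 0 := by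
        intro s hs hsσ
        by_contra hcon
        push Not at hcon
        exact absurd (csInf_le hS₃bdd ⟨⟨hs, hsσ.le.trans hσ₃S.1.2⟩, hcon⟩) (not_le.mpr hsσ)
      refine ⟨σ₁, σ₂, σ₃, hσ₁t₀, hσ₁σ₂, hσ₃S.1.1, hσ₃S.1.2, hW, hA, ?_, ?_⟩
      · rcases eq_or_lt_of_le hσ₃S.1.1 with h | h
        · exact Or.inl h.symm
        · refine Or.inr fun s hs ↦ ⟨hkpos s (hσ₁σ₂.trans hs.1) (hs.2.trans hσ₃S.1.2), ?_, ?_⟩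
          · rcases eq_or_lt_of_le hs.1 with h' | h'
            · rw [← h']; exact hgmσ₂ (h.trans_le hσ₃S.1.2)
            · exact (hgmneg s h' (hs.2.trans hσ₃S.1.2)).le
          · rcases eq_or_lt_of_le hs.2 with h' | h'
            · rw [h']; exact nonpos_of_neg_on_left hgp h hgpneg
            · exact (hgpneg s hs.1 h').le
      · exact Or.inr fun s hs ↦ ⟨hkpos s ((hσ₁σ₂.trans hσ₃S.1.1).trans hs.1) hs.2,
          hgpmono σ₃ s ((hσ₁t₀.trans hσ₁σ₂).trans hσ₃S.1.1) hs.1 hs.2 hσ₃S.2⟩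

end RegimeSplit

/-! ## Relative freezing of the tight pair -/

section TightPairFreezing

open MeasureTheory intervalIntegral

/-- **Relative freezing of the tight pair during the escape.** Abstract form: two holes `a, c` with
charges `Q_a, Q_c` read along radii `R_a, R_c` (singleton laws with constants `C_a, C_c`, errors `≤ ε`,
identifications), a third hole `b` flying by both (`d_{ba} ≥ max(m₀, |φ_{ba}|)`, `d_{bc} ≥ max(m₀, |φ_{bc}|)`,
rates `≥ g`), radii dominating `min(min(d_b·, d_{ac})/3, c₂s)`, slaving errors `≤ β₀/8` and an initial
relative velocity `< β₀/2`. If the two-partner budgets are small compared with `β₀`, the relative painted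
velocity `v_a − v_c` stays `≤ 5β₀/4` on the whole interval: at the first time it reaches `β₀` it freezes
(nested first exit: while within `β₀/4` of that value, `⟪u, ξ_a − ξ_c⟫` moves at rate `≥ β₀/2`, so `d_{ac}`
is fly-by controlled too and both singleton budgets are two-partner budgets). [folklore] -/
theorem tight_pair_relative_freezing {ξa ξb ξc va vc : ℝ → E3} {Qa Qc : ℝ → Fin 4 → ℝ}
    {Ra Rc ea ec φba φba' φbc φbc' : ℝ → ℝ} {Ma Mc Ca Cc k t₀ τ m₀ c₂ g β₀ ε : ℝ}
    (hMa : 0 < Ma) (hMc : 0 < Mc) (hk1 : k < 1) (ht₀ : 1 ≤ t₀) (hm₀ : 1 ≤ m₀)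
    (hc₂ : 0 < c₂) (hg : 0 < g) (hβ₀ : 0 < β₀) (hCa : 0 ≤ Ca) (hCc : 0 ≤ Cc)
    (hda : Differentiable ℝ ξa) (hdc : Differentiable ℝ ξc) (hdca : Continuous (deriv ξa))
    (hdcc : Continuous (deriv ξc)) (hξb : Continuous ξb) (hva : Continuous va) (hvc : Continuous vc)
    (hvak : ∀ s ∈ Set.Icc t₀ τ, ‖va s‖ ≤ k) (hvck : ∀ s ∈ Set.Icc t₀ τ, ‖vc s‖ ≤ k)
    (hsla : ∀ s ∈ Set.Icc t₀ τ, ‖deriv ξa s - va s‖ ≤ β₀ / 8)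
    (hslc : ∀ s ∈ Set.Icc t₀ τ, ‖deriv ξc s - vc s‖ ≤ β₀ / 8)
    (hlawa : ∀ t₁ t₂, t₀ ≤ t₁ → t₁ ≤ t₂ → t₂ ≤ τ → ∀ μ : Fin 4, |Qa t₂ μ - Qa t₁ μ| ≤
      Ca * (∫ s in t₁..t₂, ((Ra s) ^ 2)⁻¹ + ((Ra s) ^ (7 / 4 : ℝ))⁻¹) + ea t₁)
    (hida : ∀ t ∈ Set.Icc t₀ τ, |Qa t 0 - Ma * (√(1 - ‖va t‖ ^ 2))⁻¹| ≤ ea t ∧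
      ∀ k' : Fin 3, |Qa t k'.succ - Ma * (√(1 - ‖va t‖ ^ 2))⁻¹ * va t k'| ≤ ea t)
    (hea : ∀ t ∈ Set.Icc t₀ τ, ea t ≤ ε)
    (hlawc : ∀ t₁ t₂, t₀ ≤ t₁ → t₁ ≤ t₂ → t₂ ≤ τ → ∀ μ : Fin 4, |Qc t₂ μ - Qc t₁ μ| ≤
      Cc * (∫ s in t₁..t₂, ((Rc s) ^ 2)⁻¹ + ((Rc s) ^ (7 / 4 : ℝ))⁻¹) + ec t₁)
    (hidc : ∀ t ∈ Set.Icc t₀ τ, |Qc t 0 - Mc * (√(1 - ‖vc t‖ ^ 2))⁻¹| ≤ ec t ∧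
      ∀ k' : Fin 3, |Qc t k'.succ - Mc * (√(1 - ‖vc t‖ ^ 2))⁻¹ * vc t k'| ≤ ec t)
    (hec : ∀ t ∈ Set.Icc t₀ τ, ec t ≤ ε)
    (hRac : ContinuousOn Ra (Set.Icc t₀ τ)) (hRa1 : ∀ s ∈ Set.Icc t₀ τ, 1 ≤ Ra s)
    (hRage : ∀ s ∈ Set.Icc t₀ τ, min (min ‖ξb s - ξa s‖ ‖ξa s - ξc s‖ / 3) (c₂ * s) ≤ Ra s)
    (hRcc : ContinuousOn Rc (Set.Icc t₀ τ)) (hRc1 : ∀ s ∈ Set.Icc t₀ τ, 1 ≤ Rc s)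
    (hRcge : ∀ s ∈ Set.Icc t₀ τ, min (min ‖ξb s - ξc s‖ ‖ξa s - ξc s‖ / 3) (c₂ * s) ≤ Rc s)
    (hφba : ∀ s, HasDerivAt φba (φba' s) s) (hφba' : Continuous φba')
    (hmonoba : ∀ s ∈ Set.Icc t₀ τ, g ≤ φba' s)
    (hflba : ∀ s ∈ Set.Icc t₀ τ, max m₀ |φba s| ≤ ‖ξb s - ξa s‖)
    (hφbc : ∀ s, HasDerivAt φbc (φbc' s) s) (hφbc' : Continuous φbc')
    (hmonobc : ∀ s ∈ Set.Icc t₀ τ, g ≤ φbc' s)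
    (hflbc : ∀ s ∈ Set.Icc t₀ τ, max m₀ |φbc s| ≤ ‖ξb s - ξc s‖)
    (hfloor : ∀ s ∈ Set.Icc t₀ τ, m₀ ≤ ‖ξa s - ξc s‖)
    (hinit : ‖va t₀ - vc t₀‖ < β₀ / 2)
    (hsmall : 4 * (Ca * ((9 * (2 * 2 * m₀ ^ (1 - 2 : ℝ) / ((2 - 1) * g)) +
        (3 : ℝ) ^ (7 / 4 : ℝ) * (2 * (7 / 4) * m₀ ^ (1 - 7 / 4 : ℝ) / ((7 / 4 - 1) * g)) +
        ((c₂ ^ 2 * t₀)⁻¹ + 4 / 3 * c₂ ^ (-(7 / 4) : ℝ) * t₀ ^ (-(3 / 4) : ℝ))) +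
      (9 * (2 * 2 * m₀ ^ (1 - 2 : ℝ) / ((2 - 1) * (β₀ / 2))) +
        (3 : ℝ) ^ (7 / 4 : ℝ) * (2 * (7 / 4) * m₀ ^ (1 - 7 / 4 : ℝ) / ((7 / 4 - 1) * (β₀ / 2))) +
        ((c₂ ^ 2 * t₀)⁻¹ + 4 / 3 * c₂ ^ (-(7 / 4) : ℝ) * t₀ ^ (-(3 / 4) : ℝ)))) + 3 * ε) / Ma +
      4 * (Cc * ((9 * (2 * 2 * m₀ ^ (1 - 2 : ℝ) / ((2 - 1) * g)) +
        (3 : ℝ) ^ (7 / 4 : ℝ) * (2 * (7 / 4) * m₀ ^ (1 - 7 / 4 : ℝ) / ((7 / 4 - 1) * g)) +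
        ((c₂ ^ 2 * t₀)⁻¹ + 4 / 3 * c₂ ^ (-(7 / 4) : ℝ) * t₀ ^ (-(3 / 4) : ℝ))) +
      (9 * (2 * 2 * m₀ ^ (1 - 2 : ℝ) / ((2 - 1) * (β₀ / 2))) +
        (3 : ℝ) ^ (7 / 4 : ℝ) * (2 * (7 / 4) * m₀ ^ (1 - 7 / 4 : ℝ) / ((7 / 4 - 1) * (β₀ / 2))) +
        ((c₂ ^ 2 * t₀)⁻¹ + 4 / 3 * c₂ ^ (-(7 / 4) : ℝ) * t₀ ^ (-(3 / 4) : ℝ)))) + 3 * ε) / Mc < β₀ / 4) :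
    ∀ s ∈ Set.Icc t₀ τ, ‖va s - vc s‖ ≤ 5 * β₀ / 4 := by
  -- abbreviations for the budgets
  set Bg : ℝ := 9 * (2 * 2 * m₀ ^ (1 - 2 : ℝ) / ((2 - 1) * g)) +
      (3 : ℝ) ^ (7 / 4 : ℝ) * (2 * (7 / 4) * m₀ ^ (1 - 7 / 4 : ℝ) / ((7 / 4 - 1) * g)) +
      ((c₂ ^ 2 * t₀)⁻¹ + 4 / 3 * c₂ ^ (-(7 / 4) : ℝ) * t₀ ^ (-(3 / 4) : ℝ)) with hBg
  set B₀ : ℝ := 9 * (2 * 2 * m₀ ^ (1 - 2 : ℝ) / ((2 - 1) * (β₀ / 2))) +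
      (3 : ℝ) ^ (7 / 4 : ℝ) * (2 * (7 / 4) * m₀ ^ (1 - 7 / 4 : ℝ) / ((7 / 4 - 1) * (β₀ / 2))) +
      ((c₂ ^ 2 * t₀)⁻¹ + 4 / 3 * c₂ ^ (-(7 / 4) : ℝ) * t₀ ^ (-(3 / 4) : ℝ)) with hB₀
  have ht₀pos : 0 < t₀ := one_pos.trans_le ht₀
  have hm₀pos : 0 < m₀ := one_pos.trans_le hm₀
  have hg₀ : 0 < β₀ / 2 := by positivity
  set r : ℝ → E3 := fun s ↦ va s - vc s with hrdef
  have hrc : Continuous r := hva.sub hvc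
  -- if `‖r‖ < β₀` throughout, done
  by_cases hall : ∀ s ∈ Set.Icc t₀ τ, ‖r s‖ < β₀
  · intro s hs; have := hall s hs; simp only [hrdef] at this; linarith
  push Not at hall
  obtain ⟨s₁, hs₁, hbig⟩ := hall
  -- first hit `s₀` of level `β₀`
  obtain ⟨s₀, ht₀s₀, hs₀s₁, hs₀eq, hs₀le⟩ :=
    exists_first_exit (f := fun s ↦ ‖r s‖) (a := β₀) hrc.norm (by simp only [hrdef]; linarith) hs₁.1 hbig
  have hs₀τ : s₀ ≤ τ := hs₀s₁.trans hs₁.2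
  -- CLAIM: on `[s₀, τ]` the relative velocity stays within `β₀/4` of `r s₀`
  have hclaim : ∀ s ∈ Set.Icc s₀ τ, ‖r s - r s₀‖ ≤ β₀ / 4 := by
    by_contra hcon
    push Not at hcon
    obtain ⟨s₂, hs₂, hbad⟩ := hcon
    obtain ⟨τ', hs₀τ', hτ's₂, hτ'eq, hτ'le⟩ :=
      exists_first_exit (f := fun s ↦ ‖r s - r s₀‖) (a := β₀ / 4) (hrc.sub continuous_const).norm
        (by simp [hβ₀]) hs₂.1 hbad.le
    have hτ'τ : τ' ≤ τ := hτ's₂.trans hs₂.2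
    have hsub : Set.Icc s₀ τ' ⊆ Set.Icc t₀ τ := Set.Icc_subset_Icc ht₀s₀.le hτ'τ
    -- the unit vector along `r s₀` and the coordinate `φ = ⟪u, ξa - ξc⟫`
    set ρ : ℝ := ‖r s₀‖ with hρdef
    have hρ : ρ = β₀ := hs₀eq
    have hρpos : 0 < ρ := by rw [hρ]; exact hβ₀
    set u : E3 := ρ⁻¹ • r s₀ with hudef
    have hu : ‖u‖ = 1 := by
      rw [hudef, norm_smul, norm_inv, Real.norm_eq_abs, abs_of_pos hρpos, hρdef,
        inv_mul_cancel₀ hρpos.ne']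
    have hur : @inner ℝ E3 _ u (r s₀) = ρ := by
      rw [hudef, real_inner_smul_left, real_inner_self_eq_norm_sq, ← hρdef, sq, ← mul_assoc,
        inv_mul_cancel₀ hρpos.ne', one_mul]
    set φ : ℝ → ℝ := fun s ↦ @inner ℝ E3 _ u (ξa s - ξc s) with hφdef
    set φ' : ℝ → ℝ := fun s ↦ @inner ℝ E3 _ u (deriv ξa s - deriv ξc s) with hφ'def
    have hφd : ∀ s, HasDerivAt φ (φ' s) s := fun s ↦ hasDerivAt_inner_sub hda hdc u s
    have hφ'c : Continuous φ' := continuous_const.inner (hdca.sub hdcc)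
    have hmono : ∀ s ∈ Set.Icc s₀ τ', β₀ / 2 ≤ φ' s := by
      intro s hs
      have hs' := hsub hs
      have hrs : ‖r s - r s₀‖ ≤ β₀ / 4 := hτ'le s hs
      have hsplit : φ' s = @inner ℝ E3 _ u (r s₀) + @inner ℝ E3 _ u (r s - r s₀) +
          @inner ℝ E3 _ u ((deriv ξa s - va s) - (deriv ξc s - vc s)) := by
        simp only [hφ'def, hrdef, ← inner_add_right]
        congr 1; abel
      have h1 : |@inner ℝ E3 _ u (r s - r s₀)| ≤ β₀ / 4 := (abs_inner_le_norm_of_unit hu).trans hrs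
      have h2 : |@inner ℝ E3 _ u ((deriv ξa s - va s) - (deriv ξc s - vc s))| ≤ β₀ / 4 := by
        refine (abs_inner_le_norm_of_unit hu).trans ((norm_sub_le _ _).trans ?_)
        linarith [hsla s hs', hslc s hs']
      rw [hsplit, hur, hρ]
      rw [abs_le] at h1 h2
      linarith only [h1.1, h2.1]
    have hflac : ∀ s ∈ Set.Icc s₀ τ', max m₀ |φ s| ≤ ‖ξa s - ξc s‖ := fun s hs ↦
      max_le (hfloor s (hsub hs)) (abs_inner_le_norm_of_unit hu)
    have hs₀pos : 0 < s₀ := ht₀pos.trans ht₀s₀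
    -- two-partner budgets for `a` (partners `b` via `φba`, `c` via `φ`) and for `c`
    have hBa : ∫ s in s₀..τ', (((Ra s) ^ 2)⁻¹ + ((Ra s) ^ (7 / 4 : ℝ))⁻¹) ≤ Bg + B₀ := by
      have h := two_partner_budget_le (R := Ra) (d₁ := fun s ↦ ‖ξb s - ξa s‖)
        (d₂ := fun s ↦ ‖ξa s - ξc s‖) hs₀pos hs₀τ'.le hm₀pos hc₂ hg hg₀
        (hRac.mono hsub) (hξb.sub hda.continuous).norm (hda.continuous.sub hdc.continuous).norm
        (fun s hs ↦ hRa1 s (hsub hs)) (fun s hs ↦ hRage s (hsub hs))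
        (fun s hs ↦ hflba s (hsub hs)) hflac hφba hφba' (fun s hs ↦ hmonoba s (hsub hs))
        hφd hφ'c hmono
      refine h.trans (add_le_add ?_ ?_)
      · simp only [hBg]
        linarith [budget_tail_antitone hc₂ ht₀pos ht₀s₀.le]
      · simp only [hB₀]
        linarith [budget_tail_antitone hc₂ ht₀pos ht₀s₀.le]
    have hBc : ∫ s in s₀..τ', (((Rc s) ^ 2)⁻¹ + ((Rc s) ^ (7 / 4 : ℝ))⁻¹) ≤ Bg + B₀ := by
      have h := two_partner_budget_le (R := Rc) (d₁ := fun s ↦ ‖ξb s - ξc s‖)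
        (d₂ := fun s ↦ ‖ξa s - ξc s‖) hs₀pos hs₀τ'.le hm₀pos hc₂ hg hg₀
        (hRcc.mono hsub) (hξb.sub hdc.continuous).norm (hda.continuous.sub hdc.continuous).norm
        (fun s hs ↦ hRc1 s (hsub hs)) (fun s hs ↦ hRcge s (hsub hs))
        (fun s hs ↦ hflbc s (hsub hs)) hflac hφbc hφbc' (fun s hs ↦ hmonobc s (hsub hs))
        hφd hφ'c hmono
      refine h.trans (add_le_add ?_ ?_)
      · simp only [hBg]
        linarith [budget_tail_antitone hc₂ ht₀pos ht₀s₀.le]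
      · simp only [hB₀]
        linarith [budget_tail_antitone hc₂ ht₀pos ht₀s₀.le]
    -- nonnegativity of the budgets
    have hBnn : 0 ≤ Bg + B₀ := by
      have : 0 ≤ ∫ s in s₀..τ', (((Ra s) ^ 2)⁻¹ + ((Ra s) ^ (7 / 4 : ℝ))⁻¹) := by
        apply intervalIntegral.integral_nonneg hs₀τ'.le
        intro s hs
        have : 0 < Ra s := one_pos.trans_le (hRa1 s (hsub hs))
        positivity
      exact this.trans hBa
    -- velocity increments over `[s₀, τ']`
    have hs₀I : s₀ ∈ Set.Icc t₀ τ := ⟨ht₀s₀.le, hs₀τ⟩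
    have hτ'I : τ' ∈ Set.Icc t₀ τ := ⟨ht₀s₀.le.trans hs₀τ'.le, hτ'τ⟩
    have hIa : Ca * (∫ s in s₀..τ', (((Ra s) ^ 2)⁻¹ + ((Ra s) ^ (7 / 4 : ℝ))⁻¹)) + ea s₀ ≤
        Ca * (Bg + B₀) + ε := by
      have := mul_le_mul_of_nonneg_left hBa hCa
      linarith [hea s₀ hs₀I]
    have hIc : Cc * (∫ s in s₀..τ', (((Rc s) ^ 2)⁻¹ + ((Rc s) ^ (7 / 4 : ℝ))⁻¹)) + ec s₀ ≤
        Cc * (Bg + B₀) + ε := by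
      have := mul_le_mul_of_nonneg_left hBc hCc
      linarith [hec s₀ hs₀I]
    have hva' : ‖va τ' - va s₀‖ ≤ 4 * (Ca * (Bg + B₀) + 3 * ε) / Ma := by
      have h := velocity_increment_le hMa ((hvak τ' hτ'I).trans_lt hk1) ((hvak s₀ hs₀I).trans hk1.le)
        (hida τ' hτ'I) (hida s₀ hs₀I)
        (fun μ ↦ (hlawa s₀ τ' ht₀s₀.le hs₀τ'.le hτ'τ μ).trans hIa)
      refine h.trans (div_le_div_of_nonneg_right ?_ hMa.le)
      linarith [hea s₀ hs₀I, hea τ' hτ'I]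
    have hvc' : ‖vc τ' - vc s₀‖ ≤ 4 * (Cc * (Bg + B₀) + 3 * ε) / Mc := by
      have h := velocity_increment_le hMc ((hvck τ' hτ'I).trans_lt hk1) ((hvck s₀ hs₀I).trans hk1.le)
        (hidc τ' hτ'I) (hidc s₀ hs₀I)
        (fun μ ↦ (hlawc s₀ τ' ht₀s₀.le hs₀τ'.le hτ'τ μ).trans hIc)
      refine h.trans (div_le_div_of_nonneg_right ?_ hMc.le)
      linarith [hec s₀ hs₀I, hec τ' hτ'I]
    have hsum : ‖r τ' - r s₀‖ ≤ ‖va τ' - va s₀‖ + ‖vc τ' - vc s₀‖ := by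
      have : r τ' - r s₀ = (va τ' - va s₀) - (vc τ' - vc s₀) := by simp only [hrdef]; abel
      rw [this]; exact norm_sub_le _ _
    have hτ'eq' : ‖r τ' - r s₀‖ = β₀ / 4 := hτ'eq
    linarith only [hτ'eq', hsum, hva', hvc', hsmall]
  -- conclusion on `[t₀, τ]`
  intro s hs
  rcases lt_or_ge s s₀ with h | h
  · have := hs₀le s ⟨hs.1, h.le⟩
    simp only [hrdef] at this
    linarith
  · have h1 := hclaim s ⟨h, hs.2⟩
    have h2 : ‖r s‖ ≤ ‖r s - r s₀‖ + ‖r s₀‖ := norm_le_norm_sub_add _ _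
    have h3 : ‖r s₀‖ = β₀ := hs₀eq
    simp only [hrdef] at h1 h2 h3 ⊢
    linarith

end TightPairFreezing

end Summit.FinalStateConjecture.FinalStateConjecture.Theorems.ChargeKinematics

namespace Summit.FinalStateConjecture.FinalStateConjecture.Theorems

/-- REGISTERED STUB `tight_pair_relative_freezing` of the crux item stmt-FinalStateConjecture-10166 (second line lead, line
`old-light-leaves-the-cone`, S4 escape series): the registered one-line signature verbatim, discharged by
`ChargeKinematics.tight_pair_relative_freezing`. [folklore] -/
theorem tight_pair_relative_freezing : open Literature.Geometry.Lorentzian Filter Topology MeasureTheory intervalIntegral in ∀ {ξa ξb ξc va vc : ℝ → E3} {Qa Qc : ℝ → Fin 4 → ℝ} {Ra Rc ea ec φba φba' φbc φbc' : ℝ → ℝ} {Ma Mc Ca Cc k t₀ τ m₀ c₂ g β₀ ε : ℝ} (hMa : 0 < Ma) (hMc : 0 < Mc) (hk1 : k < 1) (ht₀ : 1 ≤ t₀) (hm₀ : 1 ≤ m₀) (hc₂ : 0 < c₂) (hg : 0 < g) (hβ₀ : 0 < β₀) (hCa : 0 ≤ Ca) (hCc : 0 ≤ Cc) (hda : Differentiable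 ℝ ξa) (hdc : Differentiable ℝ ξc) (hdca : Continuous (deriv ξa)) (hdcc : Continuous (deriv ξc)) (hξb : Continuous ξb) (hva : Continuous va) (hvc : Continuous vc) (hvak : ∀ s ∈ Set.Icc t₀ τ, ‖va s‖ ≤ k) (hvck : ∀ s ∈ Set.Icc t₀ τ, ‖vc s‖ ≤ k) (hsla : ∀ s ∈ Set.Icc t₀ τ, ‖deriv ξa s - va s‖ ≤ β₀ / 8) (hslc : ∀ s ∈ Set.Icc t₀ τ, ‖deriv ξc s - vc s‖ ≤ β₀ / 8) (hlawa : ∀ t₁ t₂, t₀ ≤ t₁ → t₁ ≤ t₂ → t₂ ≤ τ → ∀ μ : Fin 4, |Qa t₂ μ - Qa t₁ μ| ≤ Ca * (∫ s in t₁..t₂, ((Ra s) ^ 2)⁻¹ + ((Ra s) ^ (7 / 4 : ℝ))⁻¹) + ea t₁) (hida : ∀ t ∈ Set.Icc t₀ τ, |Qa t 0 - Ma * (√(1 - ‖va t‖ ^ 2))⁻¹| ≤ ea t ∧ ∀ k' : Fin 3, |Qa t k'.succ - Ma * (√(1 - ‖va t‖ ^ 2))⁻¹ * va t k'| ≤ ea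 t) (hea : ∀ t ∈ Set.Icc t₀ τ, ea t ≤ ε) (hlawc : ∀ t₁ t₂, t₀ ≤ t₁ → t₁ ≤ t₂ → t₂ ≤ τ → ∀ μ : Fin 4, |Qc t₂ μ - Qc t₁ μ| ≤ Cc * (∫ s in t₁..t₂, ((Rc s) ^ 2)⁻¹ + ((Rc s) ^ (7 / 4 : ℝ))⁻¹) + ec t₁) (hidc : ∀ t ∈ Set.Icc t₀ τ, |Qc t 0 - Mc * (√(1 - ‖vc t‖ ^ 2))⁻¹| ≤ ec t ∧ ∀ k' : Fin 3, |Qc t k'.succ - Mc * (√(1 - ‖vc t‖ ^ 2))⁻¹ * vc t k'| ≤ ec t) (hec : ∀ t ∈ Set.Icc t₀ τ, ec t ≤ ε) (hRac : ContinuousOn Ra (Set.Icc t₀ τ)) (hRa1 : ∀ s ∈ Set.Icc t₀ τ, 1 ≤ Ra s) (hRage : ∀ s ∈ Set.Icc t₀ τ, min (min ‖ξb s - ξa s‖ ‖ξa s - ξc s‖ / 3) (c₂ * s) ≤ Ra s) (hRcc : ContinuousOn Rc (Set.Icc t₀ τ)) (hRc1 : ∀ s ∈ Set.Icc t₀ τ,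 1 ≤ Rc s) (hRcge : ∀ s ∈ Set.Icc t₀ τ, min (min ‖ξb s - ξc s‖ ‖ξa s - ξc s‖ / 3) (c₂ * s) ≤ Rc s) (hφba : ∀ s, HasDerivAt φba (φba' s) s) (hφba' : Continuous φba') (hmonoba : ∀ s ∈ Set.Icc t₀ τ, g ≤ φba' s) (hflba : ∀ s ∈ Set.Icc t₀ τ, max m₀ |φba s| ≤ ‖ξb s - ξa s‖) (hφbc : ∀ s, HasDerivAt φbc (φbc' s) s) (hφbc' : Continuous φbc') (hmonobc : ∀ s ∈ Set.Icc t₀ τ, g ≤ φbc' s) (hflbc : ∀ s ∈ Set.Icc t₀ τ, max m₀ |φbc s| ≤ ‖ξb s - ξc s‖) (hfloor : ∀ s ∈ Set.Icc t₀ τ, m₀ ≤ ‖ξa s - ξc s‖) (hinit : ‖va t₀ - vc t₀‖ < β₀ / 2) (hsmall : 4 * (Ca * ((9 * (2 * 2 * m₀ ^ (1 - 2 : ℝ) / ((2 - 1) * g)) + (3 : ℝ) ^ (7 / 4 : ℝ) * (2 * (7 / 4) * m₀ ^ (1 - 7 / 4 : ℝ) / ((7 / 4 - 1) * g)) + ((c₂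 ^ 2 * t₀)⁻¹ + 4 / 3 * c₂ ^ (-(7 / 4) : ℝ) * t₀ ^ (-(3 / 4) : ℝ))) + (9 * (2 * 2 * m₀ ^ (1 - 2 : ℝ) / ((2 - 1) * (β₀ / 2))) + (3 : ℝ) ^ (7 / 4 : ℝ) * (2 * (7 / 4) * m₀ ^ (1 - 7 / 4 : ℝ) / ((7 / 4 - 1) * (β₀ / 2))) + ((c₂ ^ 2 * t₀)⁻¹ + 4 / 3 * c₂ ^ (-(7 / 4) : ℝ) * t₀ ^ (-(3 / 4) : ℝ)))) + 3 * ε) / Ma + 4 * (Cc * ((9 * (2 * 2 * m₀ ^ (1 - 2 : ℝ) / ((2 - 1) * g)) + (3 : ℝ) ^ (7 / 4 : ℝ) * (2 * (7 / 4) * m₀ ^ (1 - 7 / 4 : ℝ) / ((7 / 4 - 1) * g)) + ((c₂ ^ 2 * t₀)⁻¹ + 4 / 3 * c₂ ^ (-(7 / 4) : ℝ) * t₀ ^ (-(3 / 4) : ℝ))) + (9 * (2 * 2 * m₀ ^ (1 - 2 : ℝ) / ((2 - 1) * (β₀ / 2))) + (3 : ℝ) ^ (7 / 4 : ℝ) *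 (2 * (7 / 4) * m₀ ^ (1 - 7 / 4 : ℝ) / ((7 / 4 - 1) * (β₀ / 2))) + ((c₂ ^ 2 * t₀)⁻¹ + 4 / 3 * c₂ ^ (-(7 / 4) : ℝ) * t₀ ^ (-(3 / 4) : ℝ)))) + 3 * ε) / Mc < β₀ / 4), ∀ s ∈ Set.Icc t₀ τ, ‖va s - vc s‖ ≤ 5 * β₀ / 4 :=
  @ChargeKinematics.tight_pair_relative_freezing

end Summit.FinalStateConjecture.FinalStateConjecture.Theorems

end
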